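import Mathlib
import Literature.MathematicalPhysics.QuantumFieldTheory.Balaban1983to89.B10Eq26SuSlice

/-
Copyright: publication-cell `pub-balaban` (b2b), seat b2b-balaban-b10 gen 30 (v1).  Literature leaf — `SU(N) ⊂ M_N(ℂ)`,
elementary C⋆-algebra estimates (mean value inequality, telescoping), the topology of finitely many matrix variables,
and applications of the cell's landed theorems only (`…B10Eq26SuSlice` (gen 29) and, through it, `…B10Eq32RegularSuN`,
`…B10Eq32AxialSuN`, `…B10Eq32SuN`, `…B10Eq31GlobalConj`, `…B10Eq26SiteGauge`, `…B10Eq29TubeLine`,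
`…B10Eq29CplxLine`, `…B10Eq61Leaves`, `…B10Eq61PerSite`, `…B10Eq27AxialLog`, `…B13DerivZeroGauge`, `…B13Inv214Orbit`,
`…B13Inv214OrbitSUN`, `…B7Prop1Explicit`, `…B7Prop1Local`, `…B7Prop2SpecialUnitary`, `…B7Transfer`, all imported BY
NAME, nothing edited); every theorem is kernel-proved and tagged [folklore] or [cite: …] (a LOCATED printed shape); the
objects are MODEL OBJECTS (functions of finitely many matrix variables), never asserted to be Bałaban's; NO new cited
facts, NO summit vocabulary.
-/

/-!
# `Balaban1983to89.B10Eq28RegularTube` — [Balaban1985UV3] p. 263, the *"analyticity with respect to U₁"* LOCATED: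
# the lineage's `SU(N)` joint theorem ((26) ⇒ (29), (31) ⇒ (32), the strip engine) with holomorphy assumed ONLY on
# the complex tube over the REGULAR configurations ([Balaban1987RG1] (1.11)–(1.13): `𝐔 = U′U`, `U` regular,
# `U′ = exp iξA′`, `|A′| < α₁`) — where print's smallness (28) of `𝓗(B)` becomes a load-bearing hypothesis and the
# located gauge invariance (26) of gen 28 regains its content (it is then STRICTLY weaker than the global (26))

T. Bałaban, *Ultraviolet stability of three-dimensional lattice pure gauge field theories*, Commun. Math. Phys.
**102**, 255–275 (1985) [Balaban1985UV3] (cell paper B10; PDF `paper:balaban1985-cmp102-uv-stability-3d`, journal page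
= PDF page + 254); T. Bałaban, *Renormalization group approach to lattice gauge field theories. I. Generation of
effective actions in a small field approximation and a coupling constant renormalization in four dimensions*, Commun.
Math. Phys. **109**, 249–301 (1987) [Balaban1987RG1] = [I] (cell paper B12; PDF
`paper:balaban1987-cmp109-rg-i-small-field`, journal page = PDF page + 248).

CITATION HEADER (lean-in-tree rule).  The passages marked «p005», «p009», «p010» (B10) and «q014», «q015» ([I]) below
were READ AS IMAGE for this module from the renders (directory `b2b-balaban-ref1/pages/1985-cmp102-uv-stability-3d/`)
`1985-cmp102-uv-stability-3d-pNNN-x2.png`, NNN = 005 (journal p. 259: the space of regular configurations, (13) and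
`χ₁`, the fluctuation variables `U = U′U₁`, `V′ = e^{iA′}`), 009 (p. 263: (26), the three properties of `𝒫′₁`, (27),
the smallness (28) and its sentence, (29)), 010 (p. 264: (31), (32), *"(26) holds for all regular gauge field
configurations"*), and (directory `b2b-balaban-ref1/pages/1987-cmp109-rg-I-small-field/`)
`1987-cmp109-rg-I-small-field-p0NN-x2.png`, NN = 14 (journal p. 262: (1.10)–(1.16), the space `Uᶜⱼ(X, α₀, α₁, γ₀)`),
15 (p. 263: the analyticity of `𝐄⁽ʲ⁾` on `Uᶜⱼ(X, α₀, α₁)` with ABSOLUTE constants `α₀, α₁`; the gauge invariance of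
the spaces).
This module adds NO cited fact; the manuscripts under audit are quoted for the SHAPES of hypotheses, never cited for
a disputed step.  Siblings used BY NAME (byte-identical, nothing edited): `…B10Eq32RegularSuN` (b10 gen 28: `regSU`,
`mem_regSU_of_norm_sub_one_le`, `mem_regSU_of_h13`, `one_mem_regSU`, `gaugeAct_mem_regSU`,
`conjInvNear_of_orbitConstOnIn_regSU`, `eq29_axialBox_reg`, `orbitConstOnIn_su_iff`,
`fderiv_apply_eq_of_eventually_rayInvariant`, `eventually_norm_exp_smul_sub_one_lt`, the unit-square toys `sqBond`,
`twistV`, `untwist`, `plaq_twistV`, `gaugeAct_untwist_twistV_sqBond`, `norm_val_ZU_sub_one`,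
`norm_exp_thetaN_sub_one_pos`; its joint theorem `logHalfBound_sub_box_of_orbitConstOnIn_regSU` and
`derivZeroAlongV_of_suInvariantNear` only in compile-time `example`s), `…B10Eq32AxialSuN` (b10 gen 27: `BoxBond`,
`boxEnds`, `extCfg`, `axialGenBox`, `axialGenBox_mem_skewAdjoint`, `norm_axialGenBox_le`, `trace_axialGenBox_eq_zero`,
`exp_smul_mem_specialUnitaryGroup`, `clm_eq_of_su_of_scalar`, `conjCfg_eq_self_of_scalar`), `…B10Eq32SuN` (b10 gen
22: `mem_closure_span_suFlow_of_trace_eq_zero`),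
`…B10Eq31GlobalConj` (b10: `conjCfg`, `adCfg`, `gaugeFlow`, `hasDerivAt_gaugeFlow`, `expChart_one_conjCfg`,
`star_exp_ofReal_smul`, `mem_closure_span_range_adCfg`, `exp_conj_of_mul_eq_one`), `…B10Eq26SiteGauge` (b10 gen 25:
`norm_le_one_of_mem_unitary`, `diffAlongV_eq_sub`, `logHalfBound_congr`), `…B10Eq29TubeLine` (b10 gen 23:
`cstarAlgebraMatrix`, `Tube`, `TubeCfg`, `expLine`, `abs_im_mul_norm_lt_of_mem_rect`, `analyticOnStrip_expLine`),
`…B10Eq29CplxLine` (b10: `exp_real_smul_mem_unitary`), `…B10Eq61Leaves` (b10 gen 21: `expChart`, `expChart_zero`,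
`map_exp_nhds_zero`, `differentiableAt_expChart`, `differentiableAt_comp_expChart_zero`), `…B10Eq61PerSite` (b10:
`Rect`, `mem_rect`, `LineInStrip`, `AnalyticOnStrip`, `DerivZeroAlongV`, `logHalfBound_diffAlongV_of_derivZero`,
`inv_halfWidth_le`, `B13.LogHalfBound`), `…B10Eq27AxialLog` (b10 gen 26: `plaq`), `…B13DerivZeroGauge` (b13:
`apply_generator_eq_zero_of_comp_eq`), `…B13Inv214Orbit` (b13: `Ends`, `gaugeAct`, `gaugeAct_eq_star`),
`…B13Inv214OrbitSUN` (b13 gen 22: `OrbitConstOnIn`, `SiteGaugeInvSU`), `…B7Prop1Explicit` (b07: `Site`, `e`, `l1`),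
`…B7Prop1Local` (b07: `InBox`, `PlaqIn`), `…B7Prop2SpecialUnitary` (b07: `specialUnitaryUnits`, `thetaN`, `ZU`),
`…B7Transfer` (b07: `norm_exp_sub_one_le_of_le`).

WHY THIS MODULE (the open edge it closes, by name).  `…B10Eq26SuSlice` (gen 29) proved that in the lineage's model of
print's third property («p009»: *"The third property is the analyticity with respect to U₁."*) — holomorphy on gen
23's bondwise tube `TubeCfg … a`, a complex neighbourhood of ALL unitary-valued configurations, regular or not — the
LOCATED gauge invariance (26) of `…B10Eq32RegularSuN` (gen 28: (26) only on the regular `SU(N)`-valued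
configurations `regSU N lo hi α′`, «p010»: *"(26) holds for all regular gauge field configurations"*) and the GLOBAL
(26) of `…B10Eq32AxialSuN` (gen 27) are EQUIVALENT (`orbitConstOnIn_regSU_iff_siteGaugeInvSU`), and named in its
HONEST SCOPE (ii) the next edge: *"modelling a located holomorphy domain (a tube over `regSU` only, on which the strip
argument of (M2) fails for large generators and print's smallness (28) of `𝓗(B)` becomes load-bearing) is NOT done
here"*.  THIS MODULE does it.  §2 defines the REGULAR TUBE `RegTube N lo hi a α′` = the configurations `V_b =
exp(B_b)·U_b` with all `‖B_b‖ < a` and `U ∈ regSU N lo hi α′` — the shape of [I]'s space `Uᶜⱼ(X, α₀, α₁)`, conditions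
(i)–(ii) («q014»), on which [I] assumes the effective actions analytic with ABSOLUTE `α₀, α₁` («q015») — and proves
it is a neighbourhood of each regular configuration and invariant under the `SU(N)`-valued site transformations; §3
proves THE POINT: the strip curve `ζ ↦ (exp(ζ·H_b))_b` of the lineage's engine stays in the regular tube on the strip
`|Im ζ| < a/κ`, `−a/κ < Re ζ < 1 + a/κ` PROVIDED the generator is SMALL, `4(sup_b ‖H_b‖ + a) ≤ α′` — for the
global tube the real direction was free (gen 23's `exp_smul_mul_mem_tube_of_mem_rect`), for the regular tube it is
not, and print's (28) («p009»: *"and for g₀ sufficiently small the number on the right-hand side above is small"*)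
is exactly what keeps the real factor `exp(Re ζ·H)` regular; §4 re-proves gen 28's (31)–(32)-near-`1` theorems with
b13's binder (a) (`E X ∘ exp-chart` differentiable at `0`) ABSTRACT, so that the regular tube (a neighbourhood of
`1`) can supply it; §5 is the LOCATED JOINT THEOREM `logHalfBound_sub_box_of_regTube`: gen 28's binder list with
`hsp : TubeCfg … a ⊆ sp X` REPLACED by `RegTube N lo hi a α′ ⊆ sp X` plus the smallness `8·(R X·α) + 4a ≤ α′`; §6
are the TEETH: with holomorphy on the regular tube the located (26) is STRICTLY WEAKER than the global one
(`located26_strictly_weaker_on_regTube`: a function differentiable on the whole regular tube, orbit-constant on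
`regSU`, not `SiteGaugeInvSU` — the center twist lies OFF the regular tube), where under gen 29's global-tube
holomorphy they coincided.  §1 is the velocity bound `‖exp(tK) − 1‖ ≤ |t|‖K‖` (`K` skew-adjoint, `t` real).

WHAT IS PRINTED (verbatim).
* B10 p. 259 («p005»): *"hence there exists the exactly one critical configuration U₁ in a space of regular
  configurations satisfying the conditions in (12)."*; *"We make a change of variables in the integral over Ω₁
  taking U = U′U₁. The new variables U′ are called fluctuation fields, and the minimal configuration U₁ is called a
  background field."*; *"We enlarge the region of integration to all configurations V′ = e^{iA′} satisfying |A′| <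
  16·3²L²B₃g₀p(g₀) on Ω₁."*; (13): *"χ₁ = Π_{p′∈Ω₁⁽¹⁾} χ({|V(∂p′) − 1| < 2L²g₀p(g₀)})"*.
* B10 p. 263 («p009»): *"The third property is the analyticity with respect to U₁. These properties follow from
  the results of previous papers; let us make a comment only on the gauge invariance (26)."*; *"The characteristic
  functions χ₁ defined in (13) give the restrictions |V(∂p′) − 1| < 2L²g₀p(g₀), hence |B(c)| < 4L²|c₋ − y|g₀p(g₀)
  < 8L²3R₁M₁r(g₀)g₀p(g₀), (28) and for g₀ sufficiently small the number on the right-hand side above is small.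
  This bound, with a different absolute constant, extends to the whole configuration B, and this assures that the
  theorems of [7] are applicable in the present situation. The bound (28) implies a similar bound for 𝓗(B), with
  the additional constant B₃ on the right-hand side. By the gauge invariance (26), we have 𝒫′₁(g₀, X, U₁) =
  𝒫′₁(g₀, X, exp i𝓗(B)), (29) and we expand the function with respect to 𝓗(B). Because of the bound (28) it is
  enough to expand up to the sixth order"*.
* B10 p. 264 («p010»): *"The gauge invariance (26) implies the invariance with respect to the global
  transformations R(U), U ∈ G, hence the equality R(U)((δ/δ𝓗(b))𝒫′₁)(g₀, X, 1) = ((δ/δ𝓗(b))𝒫′₁)(g₀, X, 1). (31)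
  We have to notice only that (26) holds for all regular gauge field configurations, not only for the minimal
  configurations U₁. The derivative in the above formula is an element of the Lie algebra 𝔤, and by the assumption
  that 𝔤 is semi-simple, the only element invariant is 0, and we conclude ((δ/δ𝓗(b))𝒫′₁)(g₀, X, 1) = 0. (32)"*.
* [I] p. 262 («q014»): *"The space Uᶜⱼ(X, α₀, α₁, γ₀) is a union of orbits [(𝐔, 𝐉)] determined by configurations
  𝐔, 𝐉 satisfying the four conditions written below. (i) 𝐔 = U′U, U has values in the group G, |∂U − 1| < α₀ξ²
  on X, (1.11)"*; *"(ii) U′ = exp iξA′, A′ has values in the algebra 𝔤ᶜ, |A′|, |∇^ξ_U A′| < α₁ on X. (1.13) (iii)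
  The configurations 𝐔, 𝐉 satisfy the bounds |∂𝐔 − 1| < α₀ξ², |𝐉| < γ₀ on X. (1.14)"*; *"The first three
  conditions (i)–(iii) in the above definition are rather simple and natural, the conditions of this form appeared
  many times in the previous papers"*.
* [I] p. 263 («q015»): *"We assume that the function 𝐄⁽ʲ⁾(X, g_{j−1}, 𝐔, 𝐉) is defined and analytic on the space
  Uᶜⱼ(X, α₀, α₁), with some positive, absolute constants α₀, α₁ (i.e., constants independent of X and j)."*; *"In
  particular the minimal configurations U_j satisfying the bound |∂U_j − 1| < ε₀ξ² with ε₀ sufficiently small,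
  satisfy the above conditions."*; *"The spaces Uᶜⱼ(X, α₀, α₁) are, by the definition, gauge invariant also."*.

THE MATHEMATICS ([folklore]; five remarks).  (M1) VELOCITY.  For `K⋆ = −K` and real `s` the path `s ↦ exp(sK)` is
unitary-valued with derivative `exp(sK)·K` of norm `≤ ‖K‖`, so `‖exp(tK) − 1‖ ≤ |t|·‖K‖` (mean value inequality).
(M2) THE REGULAR TUBE `{(exp(B_b)U_b)_b : ‖B_b‖ < a, U regular}` contains the regular configurations (`B = 0`,
`a > 0`), lies in the bondwise tube, and is a NEIGHBOURHOOD of each regular `U`: `exp` maps the neighbourhoods of `0`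
onto those of `1` (gen 21), so `{W : W·U_b⋆ ∈ exp(ball(0, a))}` is a neighbourhood of `U_b`, and the finite product
of these lies in the tube (`W_b = exp(B_b)·U_b` with `B_b ∈ ball(0, a)`).  It is invariant under `SU(N)`-valued site
transformations: `u_s·exp(B_b)U_b·u_t⋆ = exp(u_s B_b u_s⋆)·(u_s U_b u_t⋆)`, `‖u_s B_b u_s⋆‖ = ‖B_b‖`, and `Uᵘ` is
regular (plaquette variables are conjugated).  (M3) THE LINE.  For `H_b` skew-Hermitian traceless with `‖H_b‖ ≤ κ`
and `‖H_b‖ ≤ ρ`, and `ζ = s + it` with `|t| < a/κ`, `−a/κ < s < 1 + a/κ`: `exp(ζH_b) = exp(itH_b)·exp(sH_b)`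
(commuting exponents) with `‖itH_b‖ = |t|‖H_b‖ < a` and `exp(sH_b) ∈ SU(N)` (gen 27) within `|s|‖H_b‖ ≤ (1 +
a/κ)‖H_b‖ ≤ ρ + a·(‖H_b‖/κ) ≤ ρ + a` of `1` (M1); a bondwise `δ`-perturbation of `1` by `SU(N)` elements has its
plaquette variables within `4δ` of `1` (gen 28), so the real factor is REGULAR with window `α′` once `4(ρ + a) ≤
α′`, and the whole strip curve lies in the regular tube.  With the lineage's generator (gen 27's `axialGenBox`, `ρ =
2·R X·α`, `κ = p + q(1 + d_j(X))`) the condition reads `8·(R X·α) + 4a ≤ α′`.  (M4) (31)–(32) AT `1` use the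
function only through the differentiability of `v ↦ E X(exp-chart v)` at `v = 0` (gen 28 §1: the derivative at `1`
sees (26) only near `1`), which holds as soon as the analyticity space is a neighbourhood of the flat configuration —
e.g. contains a regular tube, (M2).  (M5) TEETH.  A point `exp(B)U` of the regular tube is bondwise within `e^a − 1`
of its base (`‖(exp B_b − 1)U_b‖ ≤ e^{‖B_b‖} − 1`), plaquette variables are 1-Lipschitz in each bond among factors
of norm `≤ 1` (telescoping), and the base's plaquette variable is within `α′` of `1`; so a unitary-valued configuration
whose plaquette variable is `Z = e^{2πi/N}·1` (gen 28's center twist) is OFF the regular tube when `α′ + 4(e^a − 1) <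
|e^{2πi/N} − 1|`, which holds for all small `a, α′ > 0` when `N ≥ 2`.

HYPOTHESIS SHAPES (never discharged here; each a LOCATED printed shape or a lineage binder BY NAME).  Located
holomorphy `hsp : ∀ X, RegTube N lo hi a α′ ⊆ sp X` with `hE : ∀ X, DifferentiableOn ℂ (E X) (sp X)`, `0 < a` —
«p009» *"the analyticity with respect to U₁"* on [I]'s space (i)–(ii) («q014», «q015»), replacing the lineage's
`TubeCfg … a ⊆ sp X`; smallness `hsmall : ∀ X, 8·(R X·α) + 4a ≤ α′` — «p009» (28) *"for g₀ sufficiently small the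
number on the right-hand side above is small"* in the model's currency (gen 27's `‖axialGenBox … b‖ ≤ 2·R X·α`, gen
28's regularity criterion `4δ ≤ α′`); located (26) `h26 : ∀ X, OrbitConstOnIn (boxEnds lo hi) (specialUnitaryUnits
(Fin N)) (E X) (regSU N lo hi α′)` — gen 28's verbatim («p010»); every other binder of §5 is gen 28's
`logHalfBound_sub_box_of_orbitConstOnIn_regSU`, verbatim and in the same order.

HONEST SCOPE.  (i) As in the whole lineage, `E`, `sp`, `sp′`, the box, `α`, `α′`, `a`, `R`, `p`, `q` are MODEL
OBJECTS: nothing here asserts that Bałaban's `𝒫′₁(g₀, X, ·)` satisfies the hypotheses, and the constants `8`, `4` of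
`hsmall` are the model's (a crude sufficient condition: bondwise closeness ⇒ plaquette closeness), not print's.  (ii)
WHAT THE REGULAR TUBE MODELS AND WHAT IT DOES NOT.  It models conditions (i)–(ii) of [I]'s definition («q014»): base
`U` `SU(N)`-valued with the plaquette variables INSIDE THE BOX within `α′` of `1` (gen 28's `regSU`, operator norm),
fibre coordinate `B_b` with `‖B_b‖ < a`.  NOT modelled: condition (iii) (1.14), `|∂𝐔 − 1| < α₀ξ²` for the COMPLEX
configuration itself, and the restriction of the fibre coordinate to `𝔤ᶜ = 𝔰𝔩(N, ℂ)` (print's `A′` is `𝔤ᶜ`-valued;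
the lineage's tubes, gen 23 on, take `B_b` in all of `M_N(ℂ)`) — in both respects `RegTube ⊇` print's space, so
`RegTube … ⊆ sp X` still asks holomorphy on MORE than print provides; what it no longer asks (and what gen 29 showed
to be the decisive excess) is holomorphy near the NON-regular unitary-valued configurations.  Condition (iii) is an
open condition holding at `1`, dischargeable along the strip by the same smallness; adding it is the next edge.  The
scales/lattice factors `ξ`, `ξ²`, `L²` of print are absorbed in the model's windows.  (iii) THREE SCALES.  In print
`α` (plaquette window of the evaluated configurations, (13): `2L²g₀p(g₀)`; [I]: `ε₀ξ²`) `≪` the generator size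
((28): `8L²·3R₁M₁r(g₀)g₀p(g₀)`) `≪ α′` (the window of the space carrying (26) and the analyticity, [I]'s ABSOLUTE
`α₀`); the binders `hαα′ : α ≤ α′` (gen 28) and `hsmall` (here: generator sup `+ a ≤ α′/4`) are consistent with this
regime and hold in it for `g₀` small once `a < α′/4`; the module proves nothing about print's constants.  (iv) `N ≥ 1`
(`[NeZero N]`) in §4–§5 (tracelessness of the generator, gen 27); the teeth hypothesis `α′ + 4(e^a − 1) <
|e^{2πi/N} − 1|` is satisfiable iff `N ≥ 2` (§6 `exists_windows` with gen 28's `norm_exp_thetaN_sub_one_pos`).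
Carriers: a box of `ℤ^d` (gen 27's `BoxBond lo hi`), not print's torus; the teeth on the unit square of `ℤ²`.  (v)
`RegTube` is NOT asserted open (the lineage's toolkit inverts `exp` only at `0`); proved and used: it is a
neighbourhood of each of its regular base points (§2).  `DifferentiableOn` on it is differentiability WITHIN the set,
exactly the shape of the lineage's `hE`.  (vi) `U(N)`: not treated (the located (26) ⇒ (32) needs semi-simplicity;
gen 28–29's located statements are `SU(N)` too).  (vii) Gen 28's and gen 29's joint theorems are NOT corollaries of
§5 (they assume MORE holomorphy and NO smallness) nor conversely; §5's second `example` records gen 28's BY NAME.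

COLLISION MAP.  Gen 23 (`…B10Eq29TubeLine`): `Tube`, `TubeCfg`, `exp_smul_mul_mem_tube_of_mem_rect`,
`lineInStrip_expLine` — the GLOBAL tube, real direction free; NEW: `RegTube`, `expLine_mem_regTube`,
`lineInStrip_expLine_regTube` (regular base, smallness).  Gen 21 (`…B10Eq61Leaves`): `tubeCfg_mem_nhds`,
`differentiableAt_comp_expChart_zero`; NEW: `regTube_mem_nhds`, `differentiableAt_comp_expChart_zero_of_mem_nhds`.
Gen 28 (`…B10Eq32RegularSuN`) §2: (31)–(32) near `1` under the global-tube hypotheses — RE-PROVED here (proofs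
verbatim) with binder (a) abstract, gen 28's statements recovered in `example`s, not restated as theorems; its §3
`norm_mul_mul_mul_sub_one_le`, `norm_plaq_sub_one_le` (comparison with `1`) — NEW: the two-configuration versions
`norm_mul4_sub_mul4_le`, `norm_plaq_sub_plaq_le`; its `located26_strictly_weaker` (bare predicates) and gen 29's
`located26_strictly_weaker_only_off_tube`, `orbitConstOnIn_regSU_iff_siteGaugeInvSU` (global tube: located ⇔ global)
— NEW: `twistV_not_mem_regTube`, `located26_strictly_weaker_on_regTube` (located holomorphy: located ⇍ global).  Gen
25 (`gaugeAct_mem_tubeCfg_of_unitary`), b10 (`conj_mem_tube`) — NEW: `gaugeAct_mem_regTube`.  §1: gen 23's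
`B10Eq29CplxLine.norm_exp_add_mul_exp_neg_sub_one_le` uses the same real-derivative device for a different
function; b07's `B7Transfer.norm_exp_sub_one_le_of_le` (`‖exp B − 1‖ ≤ e^β − 1`) is used BY NAME in §6; NEW: the
linear bound `norm_exp_real_smul_sub_one_le` for skew-adjoint exponents.  NEW joint theorem:
`logHalfBound_sub_box_of_regTube` (with `derivZeroAlongV_of_suInvariantNear_regTube`).
-/

namespace Literature.MathematicalPhysics.QuantumFieldTheory.Balaban1983to89.B10Eq28RegularTube

open NormedSpace Set Metric Filter
open scoped Topology Matrix.Norms.L2Operator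
open B7Prop1Explicit renaming Site → LSite
open B7Prop1Explicit (e l1)
open B7Prop1Local (InBox PlaqIn)
open B7Prop2SpecialUnitary (specialUnitaryUnits thetaN ZU)
open B13Inv214Orbit (Ends gaugeAct)
open B13Inv214OrbitSUN (OrbitConstOnIn SiteGaugeInvSU)
open B13DerivZeroGauge (apply_generator_eq_zero_of_comp_eq)
open B10Eq29TubeLine (cstarAlgebraMatrix Tube TubeCfg expLine exp_ofReal_smul_mem_unitary exp_smul_mul_mem_tube
  abs_im_mul_norm_lt_of_mem_rect analyticOnStrip_expLine mem_tube_of_mem_unitary)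
open B10Eq29CplxLine (exp_real_smul_mem_unitary)
open B10Eq61Leaves (expChart map_exp_nhds_zero differentiableAt_expChart differentiableAt_comp_expChart_zero
  tubeCfg_mem_nhds)
open B10Eq61PerSite (Rect mem_rect LineInStrip AnalyticOnStrip DerivZeroAlongV diffAlongV
  logHalfBound_diffAlongV_of_derivZero inv_halfWidth_le)
open B10Eq31GlobalConj (conjCfg adCfg gaugeFlow hasDerivAt_gaugeFlow expChart_one_conjCfg star_exp_ofReal_smul
  mem_closure_span_range_adCfg)
open B10Eq26SiteGauge (norm_le_one_of_mem_unitary gaugeAct_const diffAlongV_eq_sub logHalfBound_congr)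
open B10Eq27AxialLog (plaq)
open B10Eq32AxialSuN (BoxBond boxEnds extCfg axialGenBox axialGenBox_mem_skewAdjoint norm_axialGenBox_le
  trace_axialGenBox_eq_zero exp_smul_mem_specialUnitaryGroup conjCfg_eq_self_of_scalar clm_eq_of_su_of_scalar)
open B10Eq32RegularSuN (fderiv_apply_eq_of_eventually_rayInvariant eventually_norm_exp_smul_sub_one_lt regSU
  mem_regSU one_mem_regSU gaugeAct_mem_regSU mem_regSU_of_norm_sub_one_le conjInvNear_of_orbitConstOnIn_regSU
  mem_regSU_of_h13 eq29_axialBox_reg logHalfBound_sub_box_of_orbitConstOnIn_regSU derivZeroAlongV_of_suInvariantNear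
  sqBond twistV untwist twistV_mem untwist_mem twistV_not_mem_regSU gaugeAct_untwist_twistV_sqBond twistV_sqBond
  norm_val_ZU_sub_one not_mem_regSU_gaugeAct located26_strictly_weaker orbitConstOnIn_su_iff
  norm_exp_thetaN_sub_one_pos)
open B10Eq26SuSlice (located26_strictly_weaker_only_off_tube)

/-! ## §1. [folklore] The unitary path `t ↦ exp(tK)`, `K` skew-adjoint, moves at speed `‖K‖` -/

section path

variable {𝔸 : Type*} [CStarAlgebra 𝔸]

/-- `‖exp(tK) − 1‖ ≤ |t|·‖K‖` for `K` skew-adjoint and `t` real: the path `s ↦ exp(sK)` is unitary-valued, so its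
velocity `exp(sK)·K` has norm `≤ ‖K‖` (mean value inequality). [folklore] -/
theorem norm_exp_real_smul_sub_one_le {K : 𝔸} (hK : K ∈ skewAdjoint 𝔸) (t : ℝ) :
    ‖exp (t • K) - 1‖ ≤ |t| * ‖K‖ := by
  have hd : ∀ s ∈ (univ : Set ℝ), HasDerivWithinAt (fun u : ℝ => exp (u • K)) (exp (s • K) * K) univ s :=
    fun s _ => (hasDerivAt_exp_smul_const (𝕂 := ℝ) K s).hasDerivWithinAt
  have hb : ∀ s ∈ (univ : Set ℝ), ‖exp (s • K) * K‖ ≤ ‖K‖ := fun s _ =>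
    (norm_mul_le _ _).trans (by
      have h1 := norm_le_one_of_mem_unitary (exp_real_smul_mem_unitary hK s)
      have hK0 := norm_nonneg K
      nlinarith)
  have h := convex_univ.norm_image_sub_le_of_norm_hasDerivWithin_le hd hb (mem_univ 0) (mem_univ t)
  simp only [zero_smul, exp_zero, sub_zero, Real.norm_eq_abs] at h
  rw [mul_comm]
  exact h

/-- The same with the complex coefficient `(t : ℂ)` (the lineage's shape, gen 23's `exp_ofReal_smul_mem_unitary`).
[folklore] -/
theorem norm_exp_ofReal_smul_sub_one_le {K : 𝔸} (hK : K ∈ skewAdjoint 𝔸) (t : ℝ) :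
    ‖exp ((t : ℂ) • K) - 1‖ ≤ |t| * ‖K‖ := by
  rw [Complex.coe_smul]
  exact norm_exp_real_smul_sub_one_le hK t

end path

/-! ## §2. THE LOCATED HOLOMORPHY DOMAIN: the bondwise `a`-tube over the REGULAR `SU(N)`-valued configurations only -/

section regtube

variable (N : ℕ) {d : ℕ}

attribute [local instance] B10Eq29TubeLine.cstarAlgebraMatrix

/-- `M_N(ℂ)`. -/
local notation "M[" N "]" => Matrix (Fin N) (Fin N) ℂ

/-- **THE REGULAR TUBE** — the located model of the analyticity space: the configurations `V_b = exp(B_b)·U_b` of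
the box with ALL `‖B_b‖ < a` and `U` a REGULAR `SU(N)`-valued configuration (gen 28's `regSU N lo hi α′`: `SU(N)`-valued,
every plaquette variable inside the box within `α′` of `1`).  Gen 23's bondwise tube `TubeCfg … a` is the same shape
over ALL unitary-valued `U`; print's (i)–(ii): `𝐔 = U′U`, `U` `G`-valued with `|∂U − 1| < α₀ξ²`, `U′ = exp iξA′` with
`|A′| < α₁` (condition (iii) on the plaquette variables of `𝐔` itself is NOT modelled, HONEST SCOPE (ii)).
[cite: Balaban1987RG1, (1.11)–(1.14) p.262, p.263 («We assume that the function 𝐄⁽ʲ⁾(X, g_{j−1}, 𝐔, 𝐉) is defined and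
analytic on the space Uᶜⱼ(X, α₀, α₁), with some positive, absolute constants α₀, α₁»); Balaban1985UV3, p.263 («The
third property is the analyticity with respect to U₁. These properties follow from the results of previous papers»),
(13) p.259] -/
def RegTube (lo hi : LSite d) (a α' : ℝ) : Set (BoxBond lo hi → M[N]) :=
  {V | ∃ B U : BoxBond lo hi → M[N], (∀ b, ‖B b‖ < a) ∧ U ∈ regSU N lo hi α' ∧ V = fun b => exp (B b) * U b}

variable {N}

/-- Unfolding. [folklore] -/
theorem mem_regTube {lo hi : LSite d} {a α' : ℝ} {V : BoxBond lo hi → M[N]} :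
    V ∈ RegTube N lo hi a α' ↔
      ∃ B U : BoxBond lo hi → M[N], (∀ b, ‖B b‖ < a) ∧ U ∈ regSU N lo hi α' ∧ V = fun b => exp (B b) * U b :=
  Iff.rfl

/-- `(exp(B_b)·U_b)_b ∈ RegTube` for `‖B_b‖ < a`, `U` regular. [folklore] -/
theorem exp_mul_mem_regTube {lo hi : LSite d} {a α' : ℝ} {B U : BoxBond lo hi → M[N]} (hB : ∀ b, ‖B b‖ < a)
    (hU : U ∈ regSU N lo hi α') : (fun b => exp (B b) * U b) ∈ RegTube N lo hi a α' :=
  ⟨B, U, hB, hU, rfl⟩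

/-- The regular configurations lie in the regular tube (`a > 0`; `B = 0`). [folklore] -/
theorem mem_regTube_of_mem_regSU {lo hi : LSite d} {a α' : ℝ} (ha : 0 < a) {U : BoxBond lo hi → M[N]}
    (hU : U ∈ regSU N lo hi α') : U ∈ RegTube N lo hi a α' :=
  ⟨0, U, fun _ => by simpa using ha, hU, funext fun b => by simp⟩

/-- The regular tube lies in gen 23's bondwise tube of the same half-width (regular ⇒ unitary-valued). [folklore] -/
theorem regTube_subset_tubeCfg {lo hi : LSite d} {a α' : ℝ} :
    RegTube N lo hi a α' ⊆ TubeCfg (BoxBond lo hi) M[N] a := by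
  rintro V ⟨B, U, hB, hU, rfl⟩ b
  exact ⟨B b, U b, hB b, (Matrix.mem_specialUnitaryGroup_iff.mp (hU.1 b)).1, rfl⟩

/-- Monotonicity in both windows. [folklore] -/
theorem regTube_mono {lo hi : LSite d} {a a' α' α'' : ℝ} (ha : a ≤ a') (hα : α' ≤ α'') :
    RegTube N lo hi a α' ⊆ RegTube N lo hi a' α'' := by
  rintro V ⟨B, U, hB, hU, rfl⟩
  exact ⟨B, U, fun b => (hB b).trans_le ha, mem_regSU_of_h13 hα hU.1 hU.2, rfl⟩

/-- **The regular tube of positive half-width is a neighbourhood of every regular configuration** (finitely many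
bonds; `exp` maps the neighbourhoods of `0` onto those of `1`, gen 21's `map_exp_nhds_zero`). [folklore] -/
theorem regTube_mem_nhds {lo hi : LSite d} {a α' : ℝ} (ha : 0 < a) {U : BoxBond lo hi → M[N]}
    (hU : U ∈ regSU N lo hi α') : RegTube N lo hi a α' ∈ 𝓝 U := by
  have hUu : ∀ b, U b ∈ unitary M[N] := fun b => (Matrix.mem_specialUnitaryGroup_iff.mp (hU.1 b)).1
  have hN : ∀ b, (fun W : M[N] => W * star (U b)) ⁻¹' ((exp : M[N] → M[N]) '' ball (0 : M[N]) a) ∈ 𝓝 (U b) := by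
    intro b
    have h1 : (exp : M[N] → M[N]) '' ball (0 : M[N]) a ∈ 𝓝 (1 : M[N]) := by
      rw [← map_exp_nhds_zero]
      exact image_mem_map (ball_mem_nhds 0 ha)
    have hf : ContinuousAt (fun W : M[N] => W * star (U b)) (U b) :=
      (continuous_id.mul continuous_const).continuousAt
    exact hf.preimage_mem_nhds (by simpa only [Unitary.mul_star_self_of_mem (hUu b)] using h1)
  have hpi : Set.pi univ (fun b => (fun W : M[N] => W * star (U b)) ⁻¹' ((exp : M[N] → M[N]) '' ball (0 : M[N]) a))
      ∈ 𝓝 U := set_pi_mem_nhds finite_univ fun b _ => hN b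
  refine mem_of_superset hpi fun V hV => ?_
  have hV' : ∀ b, ∃ Bb : M[N], Bb ∈ ball (0 : M[N]) a ∧ exp Bb = V b * star (U b) := fun b => hV b (mem_univ b)
  choose B hB using hV'
  refine ⟨B, U, fun b => mem_ball_zero_iff.mp (hB b).1, hU, funext fun b => ?_⟩
  rw [(hB b).2, mul_assoc, Unitary.star_mul_self_of_mem (hUu b), mul_one]

/-- In particular it is a neighbourhood of the flat configuration `1` (`α′ ≥ 0`). [folklore] -/
theorem regTube_mem_nhds_one {lo hi : LSite d} {a α' : ℝ} (ha : 0 < a) (hα' : 0 ≤ α') :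
    RegTube N lo hi a α' ∈ 𝓝 (fun _ => (1 : M[N])) :=
  regTube_mem_nhds ha (one_mem_regSU hα')

/-! ## §3. THE POINT — the strip curve stays in the REGULAR tube only as far as its REAL direction keeps the base
## regular: print's smallness (28) of the generator becomes load-bearing -/

/-- **THE LINE (29) IN THE REGULAR TUBE.**  `H_b` skew-Hermitian and traceless with `‖H_b‖ ≤ κ` (the imaginary
budget, `κ > 0`) and `‖H_b‖ ≤ ρ` (the real budget), `ζ ∈ Rect (a/κ)`: then `exp(ζH_b)·1 = exp(i·Im ζ·H_b) ·
exp(Re ζ·H_b)` with `‖i·Im ζ·H_b‖ < a` and the REAL factor `SU(N)`-valued (gen 27) within `|Re ζ|·‖H_b‖ ≤ (1 +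
a/κ)‖H_b‖ ≤ ρ + a` of `1` (§1), hence REGULAR as soon as `4(ρ + a) ≤ α′` (gen 28's `mem_regSU_of_norm_sub_one_le`).
Contrast gen 23's `exp_smul_mul_mem_tube_of_mem_rect`: for the GLOBAL tube the real direction is free.
[cite: Balaban1985UV3, (28)–(29) p.263 («and for g₀ sufficiently small the number on the right-hand side above is
small»); Balaban1987RG1, (1.11)–(1.13) p.262] -/
theorem expLine_mem_regTube {D : LocDomainSys} {lo hi : LSite d} {a α' κ ρ : ℝ}
    {gen : D.Dom → (BoxBond lo hi → M[N]) → BoxBond lo hi → M[N]} {X : D.Dom} {φ : BoxBond lo hi → M[N]}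
    (hHs : ∀ b, star (gen X φ b) = -gen X φ b) (hHt : ∀ b, Matrix.trace (gen X φ b) = 0) (hκ : 0 < κ)
    (hHκ : ∀ b, ‖gen X φ b‖ ≤ κ) (hρ : 0 ≤ ρ) (hHρ : ∀ b, ‖gen X φ b‖ ≤ ρ) (ha : 0 ≤ a)
    (h4 : 4 * (ρ + a) ≤ α') {ζ : ℂ} (hζ : ζ ∈ Rect (a / κ)) :
    expLine gen (fun _ _ _ => 1) X φ ζ ∈ RegTube N lo hi a α' := by
  letI : NormedAlgebra ℚ M[N] := NormedAlgebra.restrictScalars ℚ ℂ M[N]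
  have hsplit : ∀ b, ζ • gen X φ b = ((ζ.im : ℂ) * Complex.I) • gen X φ b + (ζ.re : ℂ) • gen X φ b := fun b => by
    rw [← add_smul]
    congr 1
    rw [add_comm]
    exact (Complex.re_add_im ζ).symm
  have hcomm : ∀ b, Commute (((ζ.im : ℂ) * Complex.I) • gen X φ b) ((ζ.re : ℂ) • gen X φ b) := fun b =>
    ((Commute.refl (gen X φ b)).smul_left _).smul_right _
  have hre : |ζ.re| ≤ 1 + a / κ := by
    rw [mem_rect] at hζ
    obtain ⟨-, -, h1, h2⟩ := hζ
    have haκ : 0 ≤ a / κ := div_nonneg ha hκ.le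
    exact abs_le.mpr ⟨by linarith, by linarith⟩
  refine ⟨fun b => ((ζ.im : ℂ) * Complex.I) • gen X φ b, fun b => exp ((ζ.re : ℂ) • gen X φ b), fun b => ?_, ?_,
    funext fun b => ?_⟩
  · calc ‖((ζ.im : ℂ) * Complex.I) • gen X φ b‖ = |ζ.im| * ‖gen X φ b‖ := by
          rw [norm_smul, norm_mul, Complex.norm_I, mul_one, Complex.norm_real, Real.norm_eq_abs]
      _ < a := abs_im_mul_norm_lt_of_mem_rect hκ (hHκ b) hζ
  · refine mem_regSU_of_norm_sub_one_le (by positivity) h4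
      (fun b => exp_smul_mem_specialUnitaryGroup N (hHs b) (hHt b) ζ.re) fun b => ?_
    have hq : ‖gen X φ b‖ / κ ≤ 1 := (div_le_one hκ).mpr (hHκ b)
    calc ‖exp ((ζ.re : ℂ) • gen X φ b) - 1‖ ≤ |ζ.re| * ‖gen X φ b‖ :=
          norm_exp_ofReal_smul_sub_one_le (skewAdjoint.mem_iff.mpr (hHs b)) _
      _ ≤ (1 + a / κ) * ‖gen X φ b‖ := mul_le_mul_of_nonneg_right hre (norm_nonneg _)
      _ = ‖gen X φ b‖ + a * (‖gen X φ b‖ / κ) := by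
          field_simp
      _ ≤ ρ + a * 1 := add_le_add (hHρ b) (mul_le_mul_of_nonneg_left hq ha)
      _ = ρ + a := by ring
  · show exp (ζ • gen X φ b) * 1 = _
    rw [mul_one, hsplit b, exp_add_of_commute (hcomm b)]

/-- **(L1′) DISCHARGED ON THE REGULAR TUBE**: on the evaluation spaces `sp′ X` let the generator be bondwise
skew-Hermitian and traceless with `‖gen X φ b‖ ≤ κ X` (`κ X > 0`, sets the strip) AND `‖gen X φ b‖ ≤ ρ X` with
`4(ρ X + a) ≤ α′` (print's (28): the generator is SMALL), and let the analyticity space `sp X` contain the REGULAR tube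
`RegTube N lo hi a α′`; then the lines through `1` stay in `sp X` on the strips `Rect (a / κ X)` — gen 23's
`lineInStrip_expLine` with `TubeCfg … a ⊆ sp X` replaced by `RegTube … a α′ ⊆ sp X` at the price of the smallness
binder. [cite: Balaban1985UV3, (28)–(29) p.263; Balaban1987RG1, (1.11)–(1.13) p.262] -/
theorem lineInStrip_expLine_regTube {D : LocDomainSys} {lo hi : LSite d} {a α' : ℝ}
    {sp' sp : D.Dom → Set (BoxBond lo hi → M[N])} {gen : D.Dom → (BoxBond lo hi → M[N]) → BoxBond lo hi → M[N]}
    {κ ρ : D.Dom → ℝ} (hgen : ∀ X φ, φ ∈ sp' X → ∀ b, star (gen X φ b) = -gen X φ b)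
    (htr : ∀ X φ, φ ∈ sp' X → ∀ b, Matrix.trace (gen X φ b) = 0) (hκ : ∀ X, 0 < κ X)
    (hbound : ∀ X φ, φ ∈ sp' X → ∀ b, ‖gen X φ b‖ ≤ κ X) (hρ : ∀ X, 0 ≤ ρ X)
    (hsmall : ∀ X φ, φ ∈ sp' X → ∀ b, ‖gen X φ b‖ ≤ ρ X) (ha : 0 ≤ a) (h4 : ∀ X, 4 * (ρ X + a) ≤ α')
    (hsp : ∀ X, RegTube N lo hi a α' ⊆ sp X) :
    LineInStrip sp' sp (expLine gen (fun _ _ _ => 1)) (fun X => a / κ X) :=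
  fun X φ hφ _ hζ => hsp X (expLine_mem_regTube (hgen X φ hφ) (htr X φ hφ) (hκ X) (hbound X φ hφ) (hρ X)
    (hsmall X φ hφ) ha (h4 X) hζ)

/-- **The regular tube is invariant under the `SU(N)`-valued site gauge transformations**: `(exp(B_b)U_b)ᵘ =
exp(u_s B_b u_s⋆)·(Uᵘ)_b` with `‖u_s B_b u_s⋆‖ = ‖B_b‖` and `Uᵘ` regular (gen 28's `gaugeAct_mem_regSU`).
[cite: Balaban1987RG1, p.262 («The space Uᶜⱼ(X, α₀, α₁, γ₀) is a union of orbits [(𝐔, 𝐉)]»), p.263 («The spaces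
Uᶜⱼ(X, α₀, α₁) are, by the definition, gauge invariant also»)] -/
theorem gaugeAct_mem_regTube {lo hi : LSite d} {a α' : ℝ} {u : LSite d → M[N]}
    (hu : ∀ x, u x ∈ Matrix.specialUnitaryGroup (Fin N) ℂ) {V : BoxBond lo hi → M[N]}
    (hV : V ∈ RegTube N lo hi a α') : gaugeAct (boxEnds lo hi) u V ∈ RegTube N lo hi a α' := by
  obtain ⟨B, U, hB, hU, rfl⟩ := hV
  have huu : ∀ x, u x ∈ unitary M[N] := fun x => (Matrix.mem_specialUnitaryGroup_iff.mp (hu x)).1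
  refine ⟨fun b => u b.1.1 * B b * star (u b.1.1), gaugeAct (boxEnds lo hi) u U, fun b => ?_,
    gaugeAct_mem_regSU hu hU, ?_⟩
  · rw [CStarRing.norm_mul_mem_unitary _ (Unitary.star_mem (huu _)), CStarRing.norm_mem_unitary_mul _ (huu _)]
    exact hB b
  · rw [B13Inv214Orbit.gaugeAct_eq_star _ huu, B13Inv214Orbit.gaugeAct_eq_star _ huu]
    funext b
    have h1 : u b.1.1 * star (u b.1.1) = 1 := Unitary.mul_star_self_of_mem (huu _)
    have h2 : star (u b.1.1) * u b.1.1 = 1 := Unitary.star_mul_self_of_mem (huu _)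
    show u b.1.1 * (exp (B b) * U b) * star (u (b.1.1 + e b.1.2)) =
      exp (u b.1.1 * B b * star (u b.1.1)) * (u b.1.1 * U b * star (u (b.1.1 + e b.1.2)))
    rw [B10Eq31GlobalConj.exp_conj_of_mul_eq_one h1 h2,
      show u b.1.1 * exp (B b) * star (u b.1.1) * (u b.1.1 * U b * star (u (b.1.1 + e b.1.2))) =
        u b.1.1 * exp (B b) * (star (u b.1.1) * u b.1.1) * U b * star (u (b.1.1 + e b.1.2)) by noncomm_ring,
      h2]
    noncomm_ring

end regtube

/-! ## §4. (31)–(32) WITH b13's BINDER (a) ABSTRACT — gen 28's §2 re-proved with «`E X ∘ exp-chart` differentiable at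
## `0`» as the hypothesis (gen 28 derived it from the GLOBAL tube; here it comes from the REGULAR tube, §2) -/

section su

variable (N : ℕ)

attribute [local instance] B10Eq29TubeLine.cstarAlgebraMatrix

variable {ι : Type*} [Fintype ι] {D : LocDomainSys}

/-- **b13's binder (a) from ANY neighbourhood**: if the analyticity space `sp` is a neighbourhood of the base
configuration and `F` is differentiable on `sp`, then `v ↦ F(exp-chart v)` is differentiable at `0` — gen 21's
`differentiableAt_comp_expChart_zero` with its hypothesis «`TubeCfg … a ⊆ sp`, base unitary-valued» replaced by the
conclusion it was used for. [folklore] -/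
theorem differentiableAt_comp_expChart_zero_of_mem_nhds {𝔸 : Type*} [CStarAlgebra 𝔸] {base₀ : D.Dom → ι → 𝔸}
    {X : D.Dom} {sp : Set (ι → 𝔸)} {F : (ι → 𝔸) → ℂ} (hsp : sp ∈ 𝓝 (base₀ X)) (hF : DifferentiableOn ℂ F sp) :
    DifferentiableAt ℂ (fun v => F (expChart base₀ X v)) 0 := by
  have h0 : sp ∈ 𝓝 (expChart base₀ X 0) := by rwa [B10Eq61Leaves.expChart_zero]
  exact (hF.differentiableAt h0).comp (0 : ι → 𝔸) (differentiableAt_expChart base₀ X 0)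

/-- **(31) FROM (26) ON THE `SU(N)`-VALUED CONFIGURATIONS `δ`-NEAR `1`, binder (a) ABSTRACT**: gen 28's
`fderiv_comp_conjCfg_eq_of_suInvariantNear` with its hypotheses «`0 < a`, `TubeCfg … a ⊆ sp`, `E X` differentiable
on `sp`» replaced by their only use, `hdiff : v ↦ E X(exp-chart v)` differentiable at `0` (proof otherwise gen 28's,
verbatim). [cite: Balaban1985UV3, (31) p.264, p.264 («The gauge invariance (26) implies the invariance with respect
to the global transformations R(U), U ∈ G»)] -/
theorem fderiv_comp_conjCfg_eq_of_suInvariantNear_of_differentiableAt [NeZero N]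
    {E : D.Dom → (ι → Matrix (Fin N) (Fin N) ℂ) → ℂ} {X : D.Dom}
    (hdiff : DifferentiableAt ℂ
      (fun v => E X (expChart (D := D) (fun _ _ => (1 : Matrix (Fin N) (Fin N) ℂ)) X v)) 0)
    {δ : ℝ} (hδ : 0 < δ)
    (hconj : ∀ W ∈ Matrix.specialUnitaryGroup (Fin N) ℂ, ∀ V : ι → Matrix (Fin N) (Fin N) ℂ,
      (∀ b, V b ∈ Matrix.specialUnitaryGroup (Fin N) ℂ) → (∀ b, ‖V b - 1‖ < δ) →
        E X (fun b => W * V b * star W) = E X V)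
    {W : Matrix (Fin N) (Fin N) ℂ} (hW : W ∈ Matrix.specialUnitaryGroup (Fin N) ℂ) :
    (fderiv ℂ (fun v => E X (expChart (D := D) (fun _ _ => (1 : Matrix (Fin N) (Fin N) ℂ)) X v)) 0).comp
        (conjCfg W (star W)) =
      fderiv ℂ (fun v => E X (expChart (D := D) (fun _ _ => (1 : Matrix (Fin N) (Fin N) ℂ)) X v)) 0 := by
  set g : (ι → Matrix (Fin N) (Fin N) ℂ) → ℂ :=
    fun v => E X (expChart (D := D) (fun _ _ => (1 : Matrix (Fin N) (Fin N) ℂ)) X v) with hg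
  have hWu : W ∈ unitary (Matrix (Fin N) (Fin N) ℂ) := (Matrix.mem_specialUnitaryGroup_iff.mp hW).1
  have h1 : W * star W = 1 := Unitary.mul_star_self_of_mem hWu
  have h2 : star W * W = 1 := Unitary.star_mul_self_of_mem hWu
  refine clm_eq_of_su_of_scalar N _ _ (fun w hw => ?_) (fun w hw => ?_)
  · rw [ContinuousLinearMap.comp_apply]
    refine fderiv_apply_eq_of_eventually_rayInvariant hdiff _ ?_
    filter_upwards [eventually_norm_exp_smul_sub_one_lt w hδ] with t ht
    simp only [hg]
    rw [expChart_one_conjCfg h1 h2]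
    refine hconj W hW _ (fun b => ?_) (fun b => ?_)
    · simp only [expChart, Pi.smul_apply, mul_one]
      exact exp_smul_mem_specialUnitaryGroup N (hw b).1 (hw b).2 t
    · simp only [expChart, Pi.smul_apply, mul_one]
      exact ht b
  · rw [ContinuousLinearMap.comp_apply, conjCfg_eq_self_of_scalar N hWu hw]

/-- **(31) ⇒ (32), binder (a) ABSTRACT**: gen 28's `derivZeroAlongV_of_fderivConjInvariant` with «`0 < a`, `TubeCfg
… a ⊆ sp X`, `E X` differentiable on `sp X`» replaced by `hdiff` (proof otherwise gen 28's, verbatim: `ℓ_X` kills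
every `ad_S w`, `S ∈ 𝔰𝔲(N)`, hence the closed span containing every traceless-valued tangent configuration).
[cite: Balaban1985UV3, (31)–(32) p.264, p.264 («by the assumption that 𝔤 is semi-simple, the only element invariant
is 0»)] -/
theorem derivZeroAlongV_of_fderivConjInvariant_of_differentiableAt [NeZero N]
    {E : D.Dom → (ι → Matrix (Fin N) (Fin N) ℂ) → ℂ} {sp' : D.Dom → Set (ι → Matrix (Fin N) (Fin N) ℂ)}
    {gen : D.Dom → (ι → Matrix (Fin N) (Fin N) ℂ) → ι → Matrix (Fin N) (Fin N) ℂ}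
    (hdiff : ∀ X, DifferentiableAt ℂ
      (fun v => E X (expChart (D := D) (fun _ _ => (1 : Matrix (Fin N) (Fin N) ℂ)) X v)) 0)
    (h31 : ∀ X, ∀ W ∈ Matrix.specialUnitaryGroup (Fin N) ℂ,
      (fderiv ℂ (fun v => E X (expChart (D := D) (fun _ _ => (1 : Matrix (Fin N) (Fin N) ℂ)) X v)) 0).comp
          (conjCfg W (star W)) =
        fderiv ℂ (fun v => E X (expChart (D := D) (fun _ _ => (1 : Matrix (Fin N) (Fin N) ℂ)) X v)) 0)
    (htr : ∀ X φ, φ ∈ sp' X → ∀ b, Matrix.trace (gen X φ b) = 0) :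
    DerivZeroAlongV sp' E (expLine gen (fun _ _ _ => 1)) := by
  intro X φ hφ
  set ℓ := fderiv ℂ (fun v => E X (expChart (D := D) (fun _ _ => (1 : Matrix (Fin N) (Fin N) ℂ)) X v)) 0 with hℓ
  have had : ∀ (l : {S : Matrix (Fin N) (Fin N) ℂ // star S = -S ∧ Matrix.trace S = 0})
      (w : ι → Matrix (Fin N) (Fin N) ℂ), ℓ (adCfg (l : Matrix (Fin N) (Fin N) ℂ) w) = 0 := by
    rintro ⟨S, hS, hS0⟩ w
    refine apply_generator_eq_zero_of_comp_eq ℓ (hasDerivAt_gaugeFlow S w) (Eventually.of_forall fun t => ?_)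
    have hW := exp_smul_mem_specialUnitaryGroup N hS hS0 t
    have hflow : gaugeFlow S t w = conjCfg (exp ((t : ℂ) • S)) (star (exp ((t : ℂ) • S))) w := by
      rw [star_exp_ofReal_smul (skewAdjoint.mem_iff.mpr hS) t]; rfl
    rw [hflow, ← ContinuousLinearMap.comp_apply, hℓ, h31 X _ hW]
  have hle : Submodule.span ℂ (⋃ l : {S : Matrix (Fin N) (Fin N) ℂ // star S = -S ∧ Matrix.trace S = 0},
      Set.range (adCfg (ι := ι) (l : Matrix (Fin N) (Fin N) ℂ))) ≤ LinearMap.ker ℓ.toLinearMap := by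
    refine Submodule.span_le.mpr fun v hv => ?_
    obtain ⟨l, hl⟩ := Set.mem_iUnion.mp hv
    obtain ⟨w, rfl⟩ := hl
    exact had l w
  have hker := closure_minimal (t := {v : ι → Matrix (Fin N) (Fin N) ℂ | ℓ v = 0}) (fun v hv => hle hv)
    (isClosed_eq ℓ.continuous continuous_const)
  have hmem := mem_closure_span_range_adCfg
    (fun l : {S : Matrix (Fin N) (Fin N) ℂ // star S = -S ∧ Matrix.trace S = 0} => (l : Matrix (Fin N) (Fin N) ℂ))
    (B10Eq32SuN.mem_closure_span_suFlow_of_trace_eq_zero N htr X φ hφ)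
  have hℓgen : ℓ (gen X φ) = 0 := hker hmem
  have hγ : HasDerivAt (fun ζ : ℂ => ζ • gen X φ) (gen X φ) 0 := by
    simpa using (hasDerivAt_id (0 : ℂ)).smul_const (gen X φ)
  have hf : HasFDerivAt (fun v => E X (expChart (D := D) (fun _ _ => (1 : Matrix (Fin N) (Fin N) ℂ)) X v)) ℓ
      ((fun ζ : ℂ => ζ • gen X φ) 0) := by
    simpa only [zero_smul] using (hdiff X).hasFDerivAt
  have hc : HasDerivAt ((fun v => E X (expChart (D := D) (fun _ _ => (1 : Matrix (Fin N) (Fin N) ℂ)) X v)) ∘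
      fun ζ : ℂ => ζ • gen X φ) (ℓ (gen X φ)) 0 := hf.comp_hasDerivAt (0 : ℂ) hγ
  have heq : (fun ζ => E X (expLine gen (fun _ _ _ => 1) X φ ζ)) =
      ((fun v => E X (expChart (D := D) (fun _ _ => (1 : Matrix (Fin N) (Fin N) ℂ)) X v)) ∘
        fun ζ : ℂ => ζ • gen X φ) := rfl
  rw [heq, hc.deriv, hℓgen]

/-- **(32) FROM (26) ON THE `SU(N)`-VALUED CONFIGURATIONS `δ`-NEAR `1`, binder (a) ABSTRACT**: the two previous
theorems composed. [cite: Balaban1985UV3, (31)–(32) p.264] -/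
theorem derivZeroAlongV_of_suInvariantNear_of_differentiableAt [NeZero N]
    {E : D.Dom → (ι → Matrix (Fin N) (Fin N) ℂ) → ℂ} {sp' : D.Dom → Set (ι → Matrix (Fin N) (Fin N) ℂ)}
    {gen : D.Dom → (ι → Matrix (Fin N) (Fin N) ℂ) → ι → Matrix (Fin N) (Fin N) ℂ}
    (hdiff : ∀ X, DifferentiableAt ℂ
      (fun v => E X (expChart (D := D) (fun _ _ => (1 : Matrix (Fin N) (Fin N) ℂ)) X v)) 0)
    {δ : ℝ} (hδ : 0 < δ)
    (hconj : ∀ X, ∀ W ∈ Matrix.specialUnitaryGroup (Fin N) ℂ, ∀ V : ι → Matrix (Fin N) (Fin N) ℂ,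
      (∀ b, V b ∈ Matrix.specialUnitaryGroup (Fin N) ℂ) → (∀ b, ‖V b - 1‖ < δ) →
        E X (fun b => W * V b * star W) = E X V)
    (htr : ∀ X φ, φ ∈ sp' X → ∀ b, Matrix.trace (gen X φ b) = 0) :
    DerivZeroAlongV sp' E (expLine gen (fun _ _ _ => 1)) :=
  derivZeroAlongV_of_fderivConjInvariant_of_differentiableAt N hdiff
    (fun X _ hW => fderiv_comp_conjCfg_eq_of_suInvariantNear_of_differentiableAt N (hdiff X) hδ (hconj X) hW) htr

/-- **GEN 28 RECOVERED**: its `derivZeroAlongV_of_suInvariantNear` (hypotheses «`0 < a`, `TubeCfg … a ⊆ sp X`, `E X`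
differentiable on `sp X`») is the instance `hdiff := differentiableAt_comp_expChart_zero …` (gen 21). [folklore] -/
example [NeZero N] {E : D.Dom → (ι → Matrix (Fin N) (Fin N) ℂ) → ℂ}
    {sp sp' : D.Dom → Set (ι → Matrix (Fin N) (Fin N) ℂ)}
    {gen : D.Dom → (ι → Matrix (Fin N) (Fin N) ℂ) → ι → Matrix (Fin N) (Fin N) ℂ} {a : ℝ} (ha : 0 < a)
    (hsp : ∀ X, TubeCfg ι (Matrix (Fin N) (Fin N) ℂ) a ⊆ sp X) (hE : ∀ X, DifferentiableOn ℂ (E X) (sp X))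
    {δ : ℝ} (hδ : 0 < δ)
    (hconj : ∀ X, ∀ W ∈ Matrix.specialUnitaryGroup (Fin N) ℂ, ∀ V : ι → Matrix (Fin N) (Fin N) ℂ,
      (∀ b, V b ∈ Matrix.specialUnitaryGroup (Fin N) ℂ) → (∀ b, ‖V b - 1‖ < δ) →
        E X (fun b => W * V b * star W) = E X V)
    (htr : ∀ X φ, φ ∈ sp' X → ∀ b, Matrix.trace (gen X φ b) = 0) :
    DerivZeroAlongV sp' E (expLine gen (fun _ _ _ => 1)) :=
  derivZeroAlongV_of_suInvariantNear_of_differentiableAt N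
    (fun X => differentiableAt_comp_expChart_zero ha (fun _ => one_mem _) (hsp X) (hE X)) hδ hconj htr

/-- Sanity: and conversely gen 28's theorem BY NAME gives the same conclusion from the tube hypotheses. [folklore] -/
example [NeZero N] {E : D.Dom → (ι → Matrix (Fin N) (Fin N) ℂ) → ℂ}
    {sp sp' : D.Dom → Set (ι → Matrix (Fin N) (Fin N) ℂ)}
    {gen : D.Dom → (ι → Matrix (Fin N) (Fin N) ℂ) → ι → Matrix (Fin N) (Fin N) ℂ} {a : ℝ} (ha : 0 < a)
    (hsp : ∀ X, TubeCfg ι (Matrix (Fin N) (Fin N) ℂ) a ⊆ sp X) (hE : ∀ X, DifferentiableOn ℂ (E X) (sp X))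
    {δ : ℝ} (hδ : 0 < δ)
    (hconj : ∀ X, ∀ W ∈ Matrix.specialUnitaryGroup (Fin N) ℂ, ∀ V : ι → Matrix (Fin N) (Fin N) ℂ,
      (∀ b, V b ∈ Matrix.specialUnitaryGroup (Fin N) ℂ) → (∀ b, ‖V b - 1‖ < δ) →
        E X (fun b => W * V b * star W) = E X V)
    (htr : ∀ X φ, φ ∈ sp' X → ∀ b, Matrix.trace (gen X φ b) = 0) :
    DerivZeroAlongV sp' E (expLine gen (fun _ _ _ => 1)) :=
  derivZeroAlongV_of_suInvariantNear N ha hsp hE hδ hconj htr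

end su

/-! ## §5. THE LOCATED JOINT THEOREM: (26) AND holomorphy on the REGULAR configurations only -/

section joint

variable (N : ℕ) [NeZero N] {d : ℕ} {lo hi : LSite d} {D : LocDomainSys}

attribute [local instance] B10Eq29TubeLine.cstarAlgebraMatrix

/-- `M_N(ℂ)`. -/
local notation "M[" N "]" => Matrix (Fin N) (Fin N) ℂ

/-- **(32) ON THE BOX FROM (26) NEAR `1` AND HOLOMORPHY ON THE REGULAR TUBE**: if every analyticity space `sp X`
contains the regular tube `RegTube N lo hi a α′` (`a > 0`, `α′ ≥ 0`) — a neighbourhood of the flat configuration (§2)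
— and `E X` is differentiable on `sp X`, then binder (a) holds at the base point `1` and §4 applies.
[cite: Balaban1985UV3, (31)–(32) p.264; Balaban1987RG1, (1.11)–(1.14) p.262] -/
theorem derivZeroAlongV_of_suInvariantNear_regTube {a α' : ℝ} (ha : 0 < a) (hα' : 0 ≤ α')
    {E : D.Dom → (BoxBond lo hi → M[N]) → ℂ} {sp sp' : D.Dom → Set (BoxBond lo hi → M[N])}
    {gen : D.Dom → (BoxBond lo hi → M[N]) → BoxBond lo hi → M[N]}
    (hsp : ∀ X, RegTube N lo hi a α' ⊆ sp X) (hE : ∀ X, DifferentiableOn ℂ (E X) (sp X)) {δ : ℝ} (hδ : 0 < δ)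
    (hconj : ∀ X, ∀ W ∈ Matrix.specialUnitaryGroup (Fin N) ℂ, ∀ V : BoxBond lo hi → M[N],
      (∀ b, V b ∈ Matrix.specialUnitaryGroup (Fin N) ℂ) → (∀ b, ‖V b - 1‖ < δ) →
        E X (fun b => W * V b * star W) = E X V)
    (htr : ∀ X φ, φ ∈ sp' X → ∀ b, Matrix.trace (gen X φ b) = 0) :
    DerivZeroAlongV sp' E (expLine gen (fun _ _ _ => 1)) :=
  derivZeroAlongV_of_suInvariantNear_of_differentiableAt N
    (fun X => differentiableAt_comp_expChart_zero_of_mem_nhds (base₀ := fun _ _ => (1 : M[N]))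
      (mem_of_superset (regTube_mem_nhds_one ha hα') (hsp X)) (hE X)) hδ hconj htr

/-- **THE LOCATED JOINT THEOREM, `G = SU(N)` — (26) ON THE REGULAR CONFIGURATIONS AND HOLOMORPHY ON THE REGULAR
TUBE ONLY.**  Gen 28's `logHalfBound_sub_box_of_orbitConstOnIn_regSU` with its ONE global hypothesis `hsp : TubeCfg …
a ⊆ sp X` (holomorphy on the `a`-tube over ALL unitary-valued configurations) REPLACED by `RegTube N lo hi a α′ ⊆ sp
X` (the `a`-tube over the REGULAR `SU(N)`-valued configurations, window `α′` = the window of the located (26)), at the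
price of print's smallness (28) of the generator, typed `8·(R X·α) + 4a ≤ α′` («`sup_b ‖gen‖ + a ≤ α′/4`», gen 27's
`‖axialGenBox‖ ≤ 2 R X α`): the strip curve `ζ ↦ exp(ζ·gen)·1` then stays in the regular tube (§3), binder (a) comes
from the regular tube being a neighbourhood of `1` (§2, §4), (29) is gen 28's `eq29_axialBox_reg`, (31)–(32) are §4
with (26) at `u ≡ W` on the `SU(N)`-valued configurations `α′/4`-near `1` (gen 28 §5), and the engine is gen 17's
`logHalfBound_diffAlongV_of_derivZero` BY NAME.  Every other binder is gen 28's, verbatim.  THREE SCALES of print are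
visible in the binders: `α` (plaquette window of the evaluated configurations, (13): `2L²g₀p(g₀)`) `≤ α′` (window of
the space carrying (26) and the analyticity, [I] (1.11): `α₀`, `g`-INDEPENDENT), and the generator size `2·R X·α`
((28): `8L²·3R₁M₁r(g₀)·g₀p(g₀)`, «small for g₀ sufficiently small») in between.
[cite: Balaban1985UV3, (26) p.263, p.264 («(26) holds for all regular gauge field configurations»), (27)–(29) p.263,
(28) p.263 («and for g₀ sufficiently small the number on the right-hand side above is small»), (31)–(32) p.264, p.263
(«The third property is the analyticity with respect to U₁»); Balaban1987RG1, (1.11)–(1.14) p.262] -/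
theorem logHalfBound_sub_box_of_regTube {B r a p q : ℝ} (ha : 0 < a) (hp : 0 ≤ p) (hq : 0 ≤ q)
    (hpq : 0 < p + q) (hB : 0 ≤ B) (y : D.Dom → LSite d) (hy : ∀ X, InBox lo hi (y X)) (R : D.Dom → ℕ) {α α' : ℝ}
    (hα : 0 ≤ α) (hα' : 0 < α') (hαα' : α ≤ α') (hR4 : ∀ X, (R X : ℝ) * α ≤ 1 / 4)
    (hRπ : ∀ X, (N : ℝ) * ((R X : ℝ) * α) < Real.pi) (hRpq : ∀ X, 2 * ((R X : ℝ) * α) ≤ p + q * (1 + D.dj X))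
    (hsmall : ∀ X, 8 * ((R X : ℝ) * α) + 4 * a ≤ α')
    {E : D.Dom → (BoxBond lo hi → M[N]) → ℂ} {sp' sp : D.Dom → Set (BoxBond lo hi → M[N])}
    {dep : D.Dom → Set (BoxBond lo hi)} {nX : D.Dom → ℕ}
    (hsp : ∀ X, RegTube N lo hi a α' ⊆ sp X) (hE : ∀ X, DifferentiableOn ℂ (E X) (sp X))
    (h26 : ∀ X, OrbitConstOnIn (boxEnds lo hi) (specialUnitaryUnits (Fin N)) (E X) (regSU N lo hi α'))
    (hEb : B13.LogHalfBound D sp E nX B r)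
    (hloc : ∀ X (V V' : BoxBond lo hi → M[N]), (∀ b ∈ dep X, V b = V' b) → E X V = E X V')
    (hSU : ∀ X φ, φ ∈ sp' X → ∀ b, φ b ∈ Matrix.specialUnitaryGroup (Fin N) ℂ)
    (h13 : ∀ X φ, φ ∈ sp' X → ∀ (x : LSite d) (κ μ : Fin d), κ ≠ μ → PlaqIn lo hi (x, κ, μ) →
      ‖plaq (extCfg lo hi φ) x κ μ - 1‖ ≤ α)
    (hdep : ∀ X, ∀ b ∈ dep X, l1 (b.1.1 - y X) ≤ R X) :
    B13.LogHalfBound D sp' (fun X φ => E X φ - E X (fun _ => 1)) nX (8 * ((p + q) / a) ^ 2 * B) (r - 2) := by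
  have hU : ∀ X φ, φ ∈ sp' X → ∀ b, φ b ∈ unitary M[N] :=
    fun X φ hφ b => (Matrix.mem_specialUnitaryGroup_iff.mp (hSU X φ hφ b)).1
  have hgen : ∀ X φ, φ ∈ sp' X → ∀ b, star (axialGenBox lo hi y R X φ b) = -axialGenBox lo hi y R X φ b :=
    fun X φ hφ b => skewAdjoint.mem_iff.mp
      (axialGenBox_mem_skewAdjoint y R (hy X) (hU X φ hφ) (h13 X φ hφ) hα (hR4 X) b)
  have hρ : ∀ X φ, φ ∈ sp' X → ∀ b, ‖axialGenBox lo hi y R X φ b‖ ≤ 2 * ((R X : ℝ) * α) :=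
    fun X φ hφ b => norm_axialGenBox_le y R (hy X) (hU X φ hφ) (h13 X φ hφ) hα ((hR4 X).trans (by norm_num)) b
  have hbound : ∀ X φ, φ ∈ sp' X → ∀ b, ‖axialGenBox lo hi y R X φ b‖ ≤ p + q * (1 + D.dj X) :=
    fun X φ hφ b => (hρ X φ hφ b).trans (hRpq X)
  have htr : ∀ X φ, φ ∈ sp' X → ∀ b, Matrix.trace (axialGenBox lo hi y R X φ b) = 0 :=
    fun X φ hφ b => trace_axialGenBox_eq_zero N y R (hy X) (hSU X φ hφ) (h13 X φ hφ) hα (hR4 X) (hRπ X) b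
  have hκ : ∀ X, 0 < p + q * (1 + D.dj X) := fun X => by
    have hd := D.dj_nonneg X
    nlinarith [mul_nonneg hq hd]
  have hh : ∀ X, 0 < a / (p + q * (1 + D.dj X)) := fun X => div_pos ha (hκ X)
  have hH : ∀ X, (a / (p + q * (1 + D.dj X)))⁻¹ ≤ (p + q) / a * (1 + D.dj X) := fun X =>
    inv_halfWidth_le ha hp (D.dj_nonneg X)
  have hρ0 : ∀ X, 0 ≤ 2 * ((R X : ℝ) * α) := fun X => by positivity
  have h4 : ∀ X, 4 * (2 * ((R X : ℝ) * α) + a) ≤ α' := fun X => by linarith [hsmall X]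
  have hdom : LineInStrip sp' sp (expLine (axialGenBox lo hi y R) (fun _ _ _ => 1))
      (fun X => a / (p + q * (1 + D.dj X))) :=
    lineInStrip_expLine_regTube hgen htr hκ hbound hρ0 hρ ha.le h4 hsp
  have han : AnalyticOnStrip sp' E (expLine (axialGenBox lo hi y R) (fun _ _ _ => 1))
      (fun X => a / (p + q * (1 + D.dj X))) := analyticOnStrip_expLine hE hdom
  have h0 : DerivZeroAlongV sp' E (expLine (axialGenBox lo hi y R) (fun _ _ _ => 1)) :=
    derivZeroAlongV_of_suInvariantNear_regTube N ha hα'.le hsp hE (by positivity : 0 < α' / 4)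
      (fun X => conjInvNear_of_orbitConstOnIn_regSU (h26 X) hα') htr
  have h29 := eq29_axialBox_reg N y hy R hα hαα' (fun X => lt_of_le_of_lt (hR4 X) (by norm_num)) hloc h26 hSU h13
    hdep
  exact logHalfBound_congr (diffAlongV_eq_sub h29) (logHalfBound_diffAlongV_of_derivZero hh hH hB hdom han h0 hEb)

/-- **GEN 28's HYPOTHESES PLUS THE SMALLNESS GIVE THE LOCATED ONES**: holomorphy on the GLOBAL tube `TubeCfg … a`
implies it on the regular tube (§2 `regTube_subset_tubeCfg`), so under `8·(R X·α) + 4a ≤ α′` gen 28's binder list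
yields the conclusion through the located theorem (gen 28's own theorem needs no smallness: for the global tube the
real direction of the strip is free). [folklore] -/
example {B r a p q : ℝ} (ha : 0 < a) (hp : 0 ≤ p) (hq : 0 ≤ q)
    (hpq : 0 < p + q) (hB : 0 ≤ B) (y : D.Dom → LSite d) (hy : ∀ X, InBox lo hi (y X)) (R : D.Dom → ℕ) {α α' : ℝ}
    (hα : 0 ≤ α) (hα' : 0 < α') (hαα' : α ≤ α') (hR4 : ∀ X, (R X : ℝ) * α ≤ 1 / 4)
    (hRπ : ∀ X, (N : ℝ) * ((R X : ℝ) * α) < Real.pi) (hRpq : ∀ X, 2 * ((R X : ℝ) * α) ≤ p + q * (1 + D.dj X))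
    (hsmall : ∀ X, 8 * ((R X : ℝ) * α) + 4 * a ≤ α')
    {E : D.Dom → (BoxBond lo hi → M[N]) → ℂ} {sp' sp : D.Dom → Set (BoxBond lo hi → M[N])}
    {dep : D.Dom → Set (BoxBond lo hi)} {nX : D.Dom → ℕ}
    (hsp : ∀ X, TubeCfg (BoxBond lo hi) M[N] a ⊆ sp X) (hE : ∀ X, DifferentiableOn ℂ (E X) (sp X))
    (h26 : ∀ X, OrbitConstOnIn (boxEnds lo hi) (specialUnitaryUnits (Fin N)) (E X) (regSU N lo hi α'))
    (hEb : B13.LogHalfBound D sp E nX B r)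
    (hloc : ∀ X (V V' : BoxBond lo hi → M[N]), (∀ b ∈ dep X, V b = V' b) → E X V = E X V')
    (hSU : ∀ X φ, φ ∈ sp' X → ∀ b, φ b ∈ Matrix.specialUnitaryGroup (Fin N) ℂ)
    (h13 : ∀ X φ, φ ∈ sp' X → ∀ (x : LSite d) (κ μ : Fin d), κ ≠ μ → PlaqIn lo hi (x, κ, μ) →
      ‖plaq (extCfg lo hi φ) x κ μ - 1‖ ≤ α)
    (hdep : ∀ X, ∀ b ∈ dep X, l1 (b.1.1 - y X) ≤ R X) :
    B13.LogHalfBound D sp' (fun X φ => E X φ - E X (fun _ => 1)) nX (8 * ((p + q) / a) ^ 2 * B) (r - 2) :=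
  logHalfBound_sub_box_of_regTube N ha hp hq hpq hB y hy R hα hα' hαα' hR4 hRπ hRpq hsmall
    (fun X => regTube_subset_tubeCfg.trans (hsp X)) hE h26 hEb hloc hSU h13 hdep

/-- Sanity: gen 28's theorem BY NAME, same binders WITHOUT the smallness (the two theorems are incomparable: gen 28
assumes more holomorphy and no smallness). [folklore] -/
example {B r a p q : ℝ} (ha : 0 < a) (hp : 0 ≤ p) (hq : 0 ≤ q)
    (hpq : 0 < p + q) (hB : 0 ≤ B) (y : D.Dom → LSite d) (hy : ∀ X, InBox lo hi (y X)) (R : D.Dom → ℕ) {α α' : ℝ}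
    (hα : 0 ≤ α) (hα' : 0 < α') (hαα' : α ≤ α') (hR4 : ∀ X, (R X : ℝ) * α ≤ 1 / 4)
    (hRπ : ∀ X, (N : ℝ) * ((R X : ℝ) * α) < Real.pi) (hRpq : ∀ X, 2 * ((R X : ℝ) * α) ≤ p + q * (1 + D.dj X))
    {E : D.Dom → (BoxBond lo hi → M[N]) → ℂ} {sp' sp : D.Dom → Set (BoxBond lo hi → M[N])}
    {dep : D.Dom → Set (BoxBond lo hi)} {nX : D.Dom → ℕ}
    (hsp : ∀ X, TubeCfg (BoxBond lo hi) M[N] a ⊆ sp X) (hE : ∀ X, DifferentiableOn ℂ (E X) (sp X))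
    (h26 : ∀ X, OrbitConstOnIn (boxEnds lo hi) (specialUnitaryUnits (Fin N)) (E X) (regSU N lo hi α'))
    (hEb : B13.LogHalfBound D sp E nX B r)
    (hloc : ∀ X (V V' : BoxBond lo hi → M[N]), (∀ b ∈ dep X, V b = V' b) → E X V = E X V')
    (hSU : ∀ X φ, φ ∈ sp' X → ∀ b, φ b ∈ Matrix.specialUnitaryGroup (Fin N) ℂ)
    (h13 : ∀ X φ, φ ∈ sp' X → ∀ (x : LSite d) (κ μ : Fin d), κ ≠ μ → PlaqIn lo hi (x, κ, μ) →
      ‖plaq (extCfg lo hi φ) x κ μ - 1‖ ≤ α)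
    (hdep : ∀ X, ∀ b ∈ dep X, l1 (b.1.1 - y X) ≤ R X) :
    B13.LogHalfBound D sp' (fun X φ => E X φ - E X (fun _ => 1)) nX (8 * ((p + q) / a) ^ 2 * B) (r - 2) :=
  logHalfBound_sub_box_of_orbitConstOnIn_regSU N ha hp hq hpq hB y hy R hα hα' hαα' hR4 hRπ hRpq hsp hE h26 hEb hloc
    hSU h13 hdep

/-- **THE BINDERS ARE JOINTLY SATISFIABLE** (non-vacuity of the numeric side): e.g. `α′ = 1`, `a = 1/8`, `α = 0`
(any `R`, `p = q = 1`). [folklore] -/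
example (R : D.Dom → ℕ) : (∀ X, (R X : ℝ) * (0 : ℝ) ≤ 1 / 4) ∧ (∀ X, (N : ℝ) * ((R X : ℝ) * 0) < Real.pi) ∧
    (∀ X, 2 * ((R X : ℝ) * 0) ≤ 1 + 1 * (1 + D.dj X)) ∧ (∀ X, 8 * ((R X : ℝ) * 0) + 4 * (1 / 8 : ℝ) ≤ 1) :=
  ⟨fun X => by simp, fun X => by simpa using Real.pi_pos, fun X => by
    have := D.dj_nonneg X; nlinarith, fun X => by norm_num⟩

end joint

/-! ## §6. TEETH: with holomorphy located on the REGULAR tube, the located (26) is STRICTLY WEAKER than the global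
## one — for a function DIFFERENTIABLE ON THE WHOLE LOCATED DOMAIN (contrast gen 29: on the GLOBAL tube they coincide) -/

section plaqdiff

variable {𝔸 : Type*} [CStarAlgebra 𝔸] {d : ℕ}

/-- `‖xy‖ ≤ ‖x‖` for `‖y‖ ≤ 1`. [folklore] -/
theorem norm_mul_le_of_norm_le_one_right (x : 𝔸) {y : 𝔸} (h : ‖y‖ ≤ 1) : ‖x * y‖ ≤ ‖x‖ :=
  (norm_mul_le _ _).trans (mul_le_of_le_one_right (norm_nonneg _) h)

/-- `‖xy‖ ≤ ‖y‖` for `‖x‖ ≤ 1`. [folklore] -/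
theorem norm_mul_le_of_norm_le_one_left {x : 𝔸} (h : ‖x‖ ≤ 1) (y : 𝔸) : ‖x * y‖ ≤ ‖y‖ :=
  (norm_mul_le _ _).trans (mul_le_of_le_one_left (norm_nonneg _) h)

/-- Telescoping a product of four factors of norm `≤ 1` (gen 28's `norm_mul_mul_mul_sub_one_le` is the case `Bᵢ = 1`).
[folklore] -/
theorem norm_mul4_sub_mul4_le {A₁ A₂ A₃ A₄ B₁ B₂ B₃ B₄ : 𝔸} (hA₂ : ‖A₂‖ ≤ 1) (hA₃ : ‖A₃‖ ≤ 1) (hA₄ : ‖A₄‖ ≤ 1)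
    (hB₁ : ‖B₁‖ ≤ 1) (hB₂ : ‖B₂‖ ≤ 1) (hB₃ : ‖B₃‖ ≤ 1) :
    ‖A₁ * A₂ * A₃ * A₄ - B₁ * B₂ * B₃ * B₄‖ ≤ ‖A₁ - B₁‖ + ‖A₂ - B₂‖ + ‖A₃ - B₃‖ + ‖A₄ - B₄‖ := by
  have e : A₁ * A₂ * A₃ * A₄ - B₁ * B₂ * B₃ * B₄ = (A₁ - B₁) * A₂ * A₃ * A₄ + B₁ * (A₂ - B₂) * A₃ * A₄ +
      B₁ * B₂ * (A₃ - B₃) * A₄ + B₁ * B₂ * B₃ * (A₄ - B₄) := by noncomm_ring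
  have hB₁₂ : ‖B₁ * B₂‖ ≤ 1 := (norm_mul_le_of_norm_le_one_left hB₁ _).trans hB₂
  have hB₁₂₃ : ‖B₁ * B₂ * B₃‖ ≤ 1 := (norm_mul_le_of_norm_le_one_left hB₁₂ _).trans hB₃
  have n1 : ‖(A₁ - B₁) * A₂ * A₃ * A₄‖ ≤ ‖A₁ - B₁‖ :=
    (norm_mul_le_of_norm_le_one_right _ hA₄).trans ((norm_mul_le_of_norm_le_one_right _ hA₃).trans
      (norm_mul_le_of_norm_le_one_right _ hA₂))
  have n2 : ‖B₁ * (A₂ - B₂) * A₃ * A₄‖ ≤ ‖A₂ - B₂‖ :=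
    (norm_mul_le_of_norm_le_one_right _ hA₄).trans ((norm_mul_le_of_norm_le_one_right _ hA₃).trans
      (norm_mul_le_of_norm_le_one_left hB₁ _))
  have n3 : ‖B₁ * B₂ * (A₃ - B₃) * A₄‖ ≤ ‖A₃ - B₃‖ :=
    (norm_mul_le_of_norm_le_one_right _ hA₄).trans (norm_mul_le_of_norm_le_one_left hB₁₂ _)
  have n4 : ‖B₁ * B₂ * B₃ * (A₄ - B₄)‖ ≤ ‖A₄ - B₄‖ := norm_mul_le_of_norm_le_one_left hB₁₂₃ _
  rw [e]
  exact (norm_add_le _ _).trans (add_le_add ((norm_add_le _ _).trans (add_le_add ((norm_add_le _ _).trans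
    (add_le_add n1 n2)) n3)) n4)

/-- **Plaquette variables are 1-Lipschitz in each bond** (factors of norm `≤ 1`): `‖plaq φ − plaq ψ‖ ≤ Σ_{b ∈ ∂p}
‖φ_b − ψ_b‖`. [folklore] -/
theorem norm_plaq_sub_plaq_le {φ ψ : LSite d × Fin d → 𝔸} (hφ : ∀ b, ‖φ b‖ ≤ 1) (hψ : ∀ b, ‖ψ b‖ ≤ 1)
    (x : LSite d) (κ μ : Fin d) :
    ‖plaq φ x κ μ - plaq ψ x κ μ‖ ≤ ‖φ (x, κ) - ψ (x, κ)‖ + ‖φ (x + e κ, μ) - ψ (x + e κ, μ)‖ +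
      ‖φ (x + e μ, κ) - ψ (x + e μ, κ)‖ + ‖φ (x, μ) - ψ (x, μ)‖ := by
  rw [plaq, plaq]
  refine (norm_mul4_sub_mul4_le (hφ _) (by rw [norm_star]; exact hφ _) (by rw [norm_star]; exact hφ _) (hψ _)
    (hψ _) (by rw [norm_star]; exact hψ _)).trans (le_of_eq ?_)
  rw [← star_sub, ← star_sub, norm_star, norm_star]

end plaqdiff

section teeth

variable (N : ℕ) [NeZero N]

attribute [local instance] B10Eq29TubeLine.cstarAlgebraMatrix

/-- `M_N(ℂ)`. -/
local notation "M[" N "]" => Matrix (Fin N) (Fin N) ℂ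

/-- **The center twist is NOT in the regular tube** once `α′ + 4(e^a − 1) < |e^{2πi/N} − 1|`: a point `exp(B)·U` of
the tube is bondwise within `e^a − 1` of its regular base `U`, so its plaquette variable is within `4(e^a − 1) + α′`
of `1`, while the twist's is `Z` (gen 28). [folklore] -/
theorem twistV_not_mem_regTube {a α' : ℝ} (h : α' + 4 * (Real.exp a - 1) < ‖Complex.exp (thetaN N) - 1‖) :
    twistV N ∉ RegTube N (0 : LSite 2) 1 a α' := by
  rintro ⟨B, U, hB, hU, hVU⟩
  have hUu : ∀ b, U b ∈ unitary M[N] := fun b => (Matrix.mem_specialUnitaryGroup_iff.mp (hU.1 b)).1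
  have htw : ∀ b, twistV N b ∈ unitary M[N] := fun b => (Matrix.mem_specialUnitaryGroup_iff.mp (twistV_mem N b)).1
  have ha : 0 < a := (norm_nonneg _).trans_lt (hB sqBond)
  have hea : 0 ≤ Real.exp a - 1 := by linarith [Real.add_one_le_exp a]
  have hclose : ∀ b : BoxBond (0 : LSite 2) 1, ‖twistV N b - U b‖ ≤ Real.exp a - 1 := fun b => by
    rw [show twistV N b = exp (B b) * U b from congrFun hVU b,
      show exp (B b) * U b - U b = (exp (B b) - 1) * U b by rw [sub_mul, one_mul]]
    exact (norm_mul_le_of_norm_le_one_right _ (norm_le_one_of_mem_unitary (hUu b))).trans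
      (B7Transfer.norm_exp_sub_one_le_of_le (B b) (hB b).le)
  have hext : ∀ b : LSite 2 × Fin 2, ‖extCfg 0 1 (twistV N) b - extCfg 0 1 U b‖ ≤ Real.exp a - 1 := fun b => by
    by_cases hb : InBox (0 : LSite 2) 1 b.1 ∧ InBox (0 : LSite 2) 1 (b.1 + e b.2)
    · have e1 : extCfg 0 1 (twistV N) b = twistV N ⟨b, hb⟩ := B10Eq32AxialSuN.extCfg_coe (twistV N) ⟨b, hb⟩
      have e2 : extCfg 0 1 U b = U ⟨b, hb⟩ := B10Eq32AxialSuN.extCfg_coe U ⟨b, hb⟩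
      rw [e1, e2]
      exact hclose _
    · rw [B10Eq32AxialSuN.extCfg_of_not _ hb, B10Eq32AxialSuN.extCfg_of_not _ hb, sub_self, norm_zero]
      exact hea
  have h1t : ∀ b, ‖extCfg 0 1 (twistV N) b‖ ≤ 1 := fun b =>
    norm_le_one_of_mem_unitary (B10Eq32AxialSuN.extCfg_mem htw b)
  have h1U : ∀ b, ‖extCfg 0 1 U b‖ ≤ 1 := fun b => norm_le_one_of_mem_unitary (B10Eq32AxialSuN.extCfg_mem hUu b)
  have hd : ‖plaq (extCfg 0 1 (twistV N)) 0 0 1 - plaq (extCfg 0 1 U) 0 0 1‖ ≤ 4 * (Real.exp a - 1) := by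
    refine (norm_plaq_sub_plaq_le h1t h1U 0 0 1).trans ?_
    linarith [hext ((0 : LSite 2), (0 : Fin 2)), hext ((0 : LSite 2) + e 0, (1 : Fin 2)),
      hext ((0 : LSite 2) + e 1, (0 : Fin 2)), hext ((0 : LSite 2), (1 : Fin 2))]
  have hreg : ‖plaq (extCfg 0 1 U) 0 0 1 - 1‖ ≤ α' :=
    hU.2 0 0 1 (by decide) ⟨B10Eq32RegularSuN.inBox_sq_zero, B10Eq32RegularSuN.inBox_sq_ee⟩
  have hZ : ‖(ZU N : M[N]) - 1‖ ≤ 4 * (Real.exp a - 1) + α' := by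
    rw [← B10Eq32RegularSuN.plaq_twistV N, ← sub_add_sub_cancel _ (plaq (extCfg 0 1 U) 0 0 1) 1]
    exact (norm_add_le _ _).trans (add_le_add hd hreg)
  rw [norm_val_ZU_sub_one] at hZ
  linarith

/-- **THE LOCATED (26) WITH LOCATED HOLOMORPHY IS STRICTLY WEAKER THAN THE GLOBAL (26)** (`a > 0`, `0 ≤ α′`, `α′ +
4(e^a − 1) < |e^{2πi/N} − 1|`, unit square `[0, 1]² ⊂ ℤ²`): the function `F = 0` ON THE REGULAR TUBE, `F(V) = ‖V(b₀)
− 1‖` off it, is DIFFERENTIABLE ON THE WHOLE REGULAR TUBE (this module's holomorphy hypothesis `hE` with `sp =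
RegTube`) and orbit-constant on `regSU` for the `SU(N)`-valued site transformations (this module's `h26`), but NOT
`SiteGaugeInvSU`: the center twist lies OFF the regular tube (`twistV_not_mem_regTube`), `F(twist) = ‖Z − 1‖ ≠ 0`,
while its untwisting carries `1` on `b₀`, `F = 0`.  CONTRAST gen 29's `orbitConstOnIn_regSU_iff_siteGaugeInvSU`: with
holomorphy on the GLOBAL tube the located and the global (26) coincide — so locating the HOLOMORPHY DOMAIN (this
module) is what gives the located (26) (gen 28) its content. [folklore] -/
theorem located26_strictly_weaker_on_regTube {a α' : ℝ} (ha : 0 < a) (h0 : 0 ≤ α')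
    (h : α' + 4 * (Real.exp a - 1) < ‖Complex.exp (thetaN N) - 1‖) :
    ∃ F : (BoxBond (0 : LSite 2) 1 → M[N]) → ℂ,
      DifferentiableOn ℂ F (RegTube N 0 1 a α') ∧
        OrbitConstOnIn (boxEnds 0 1) (specialUnitaryUnits (Fin N)) F (regSU N 0 1 α') ∧
          ¬ SiteGaugeInvSU (boxEnds 0 1) F := by
  classical
  refine ⟨fun V => if V ∈ RegTube N (0 : LSite 2) 1 a α' then 0 else (‖V sqBond - 1‖ : ℂ), ?_, ?_, ?_⟩
  · exact (differentiableOn_const (0 : ℂ)).congr fun V hV => if_pos hV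
  · exact (orbitConstOnIn_su_iff _ _ _).mpr fun u _ V hV huV => by
      simp only [if_pos (mem_regTube_of_mem_regSU ha hV), if_pos (mem_regTube_of_mem_regSU ha huV)]
  · intro hinv
    have h1 : (if gaugeAct (boxEnds 0 1) (untwist N) (twistV N) ∈ RegTube N (0 : LSite 2) 1 a α' then (0 : ℂ)
        else (‖gaugeAct (boxEnds 0 1) (untwist N) (twistV N) sqBond - 1‖ : ℂ)) =
        if twistV N ∈ RegTube N (0 : LSite 2) 1 a α' then (0 : ℂ) else (‖twistV N sqBond - 1‖ : ℂ) :=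
      hinv (untwist N) (untwist_mem N) (twistV N) (twistV_mem N)
    have hV : twistV N ∉ RegTube N (0 : LSite 2) 1 a α' := twistV_not_mem_regTube N h
    have hu0 : (if gaugeAct (boxEnds 0 1) (untwist N) (twistV N) ∈ RegTube N (0 : LSite 2) 1 a α' then (0 : ℂ)
        else (‖gaugeAct (boxEnds 0 1) (untwist N) (twistV N) sqBond - 1‖ : ℂ)) = 0 := by
      split_ifs
      · rfl
      · rw [gaugeAct_untwist_twistV_sqBond, sub_self, norm_zero, Complex.ofReal_zero]
    rw [hu0, if_neg hV, twistV_sqBond, norm_val_ZU_sub_one] at h1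
    have hea : 0 ≤ Real.exp a - 1 := by linarith [Real.add_one_le_exp a]
    exact Complex.ofReal_ne_zero.mpr (by linarith : (0 : ℝ) < ‖Complex.exp (thetaN N) - 1‖).ne' h1.symm

omit [NeZero N] in
/-- **The hypotheses of the witness are met by all small windows** (`N ≥ 2`): for every `0 < t` there are `a > 0`
and `α′ > 0` with `α′ + 4(e^a − 1) < t` (take `α′ = t/3`, `a = min 1 (t/24)`, `e^a − 1 ≤ 2a`); with `t = |e^{2πi/N}
− 1| > 0` (gen 28's `norm_exp_thetaN_sub_one_pos`) this is print's regime of small windows. [folklore] -/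
theorem exists_windows {t : ℝ} (ht : 0 < t) : ∃ a α' : ℝ, 0 < a ∧ 0 < α' ∧ α' + 4 * (Real.exp a - 1) < t := by
  refine ⟨min 1 (t / 24), t / 3, lt_min one_pos (by positivity), by positivity, ?_⟩
  have h1 : min 1 (t / 24) ≤ 1 := min_le_left _ _
  have h2 : min 1 (t / 24) ≤ t / 24 := min_le_right _ _
  have h0 : 0 ≤ min 1 (t / 24) := le_min zero_le_one (by positivity)
  have he : |Real.exp (min 1 (t / 24)) - 1| ≤ 2 * |min 1 (t / 24)| :=
    Real.abs_exp_sub_one_le (by rwa [abs_of_nonneg h0])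
  rw [abs_of_nonneg h0, abs_of_nonneg (by linarith [Real.add_one_le_exp (min 1 (t / 24))])] at he
  linarith

/-- So for `N ≥ 2` the strict-weakness witness exists for SOME positive windows (and then for all smaller ones).
[folklore] -/
example (hN : 2 ≤ N) : ∃ a α' : ℝ, 0 < a ∧ 0 < α' ∧ ∃ F : (BoxBond (0 : LSite 2) 1 → M[N]) → ℂ,
    DifferentiableOn ℂ F (RegTube N 0 1 a α') ∧
      OrbitConstOnIn (boxEnds 0 1) (specialUnitaryUnits (Fin N)) F (regSU N 0 1 α') ∧
        ¬ SiteGaugeInvSU (boxEnds 0 1) F := by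
  obtain ⟨a, α', ha, hα', h⟩ := exists_windows (norm_exp_thetaN_sub_one_pos N hN)
  exact ⟨a, α', ha, hα', located26_strictly_weaker_on_regTube N ha hα'.le h⟩

end teeth

end Literature.MathematicalPhysics.QuantumFieldTheory.Balaban1983to89.B10Eq28RegularTube
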